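import Mathlib
import HarnessLib
import Literature.Analysis.FluidPDE.MildAncientTimeDecayRegularity
import Summits.NavierStokesRegularity.NavierStokesRegularity.Theorems.PoloidalWindowDoorPoloidalWindowRigidityWindow
import Summits.NavierStokesRegularity.NavierStokesRegularity.Theorems.PoloidalWindowDoorLrcModEntireTwistingTHSlopeFunction
import Summits.NavierStokesRegularity.NavierStokesRegularity.Theorems.PoloidalWindowDoorLrcModEntireRidgeWiring
import Summits.NavierStokesRegularity.NavierStokesRegularity.Theorems.PoloidalWindowDoorLrcModEntireRidgeTwist

/-!
# Item `LrcModEntire` (stmt-NavierStokesRegularity-20428), registry twist_split v7 — THE RIDGE CHAIN OF THE (TH) COLUMN, BINDER LEVEL (memo `Cruxes/LrcModEntire/T2B-g14.md` §9–§11):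
# proper (TH) ridge + regular uniformly non-degenerate hot arc ⇒ the squared twist jet `(∂_ν∂_z v₂)²` is quasiconvex along the arc

LEAD of item 20428 ns-poloidal-K2-p3 g14 (`--supports stmt-NavierStokesRegularity-20428 --as helper`).  ONE invocation of the ridge-quasiconvexity lever for a consumer of
`stub_T2b`: every hypothesis is either a clause of the `stub_T2b` binder VERBATIM (class clauses `hdec/hcont/hmild/hdiv`, poloidality `hpol`, global (TH) `hTH`, Peakless `hpk`,
criticality of the hot set `hcrit`, hot-spot normalisation `hhot`, `hne`), a witness of PROPERNESS of the ridge in the form delivered by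
`…TwistingTHNonflatPlane.exists_fderiv_two_ne_zero_of_properRidge` (`y₁ ∈ P₀`, `c₁ ≠ 2`, `∂_{c₁}v₂(−1,y₁) ≠ 0`) with the slope condition `μ₀ ≠ 1` written at that point
(`∂₂v_{c₁} ≠ ∂_{c₁}v₂` at `y₁`), the slice bound `‖D³v(−1,·)‖ ≤ C₃` (`Literature…exists_norm_iteratedFDeriv_le_slice_of_hasTypeITimeDecay`), or the geometry of a regular hot
arc: an open parameter set `I ⊇ [a₁,a₂]`, a frame `a² + b² = 1`, speed `c ≠ 0`, `γ′ = c(−b e₀ + a e₁)`, `γ(s)` hot, normal `ν = a e₀ + b e₁`, a tube chart `e` with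
`P_z(e(s,n)) = γ(s) + nν(s) + z e₂` on `[a₁,a₂] × [−r,r]`, cold lateral edges, and UNIFORM NON-DEGENERACY at ONE point: `κ := −D²(σv₂)(γ a₁)[ν,ν] > 0` with the thin-tube
condition `64 C₃ r ≤ κ`.

Chain inside: `…TwistingTHSlopeFunction.exists_slopeFunction_near_plane` (a `C³` slope function near `P₀`) ⇒ `…RidgeWiring.kappa_beta_const_on_hotArc` (the ridge law:
`κ(s) = κ`, `β(s) = β` along the arc) ⇒ `…RidgeTwist.quasiconvexOn_sq_nuZ_of_class` (Peakless two-sided maximum principle ⇒ `α²/κ + β` quasiconvex ⇒ `α²` quasiconvex), with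
`‖D²v(−1,·)‖ ≤ C₂` discharged from the class (KNSS slice bounds).

Conclusion `quasiconvexOn_sq_nuZ_of_T2bData`: **`s ↦ (D²(σv₂(−1,·))(γ s)[ν s, e₂])²` is `QuasiconvexOn ℝ [a₁,a₂]`**, and `kappa_const_of_T2bData` / `beta_const_of_T2bData`
export the two constancies in the same currency.  With `…RidgeQuasiconvex.QuasiconvexOn.eq_of_periodic` (closed hot curves) and port-2's `…RidgeHull*` (complete branches) this is
the kernel form of «the twist jet is constant in modulus along every hot branch» — the entrance of research cell (Q4) HOMOGENEOUS NULL RIDGE.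

WHAT THIS IS NOT: not a claim about Navier–Stokes regularity and not a proof of `stub_T2b` — a necessary condition on its hypothetical ridge (bears_on LADDER-NS N0, item 20428 /
crux 19708; both OPEN, ⟨27893⟩ OPEN).
-/

set_option linter.style.longLine false
set_option linter.dupNamespace false

namespace Summit.NavierStokesRegularity.NavierStokesRegularity.Theorems.PoloidalWindowDoorLrcModEntireTwistingTHRidgeChain

open Set Function Filter Topology Metric
open scoped RealInnerProductSpace InnerProductSpace ContDiff
open Literature.Analysis Literature.Analysis.FluidPDE Literature.Analysis.UnboundedOperators
open Summit.NavierStokesRegularity.NavierStokesRegularity.Theorems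
open Summit.NavierStokesRegularity.NavierStokesRegularity.Theorems.PoloidalWindowDoorPoloidalWindowRigidityWindow
open Summit.NavierStokesRegularity.NavierStokesRegularity.Theorems.PoloidalWindowDoorLrcModEntireTwistingTHSlopeFunction
open Summit.NavierStokesRegularity.NavierStokesRegularity.Theorems.PoloidalWindowDoorLrcModEntireRidgeWiring
open Summit.NavierStokesRegularity.NavierStokesRegularity.Theorems.PoloidalWindowDoorLrcModEntireRidgeTwist

variable {C : ℝ} {v : ℝ → EuclideanSpace ℝ (Fin 3) → EuclideanSpace ℝ (Fin 3)}

/-- The frame normal `a e₀ + b e₁` with `a² + b² = 1` has norm `1`. -/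
theorem norm_frameNormal_eq_one {a b : ℝ} (hab : a ^ 2 + b ^ 2 = 1) :
    ‖(a • EuclideanSpace.single 0 (1 : ℝ) + b • EuclideanSpace.single 1 (1 : ℝ) : EuclideanSpace ℝ (Fin 3))‖ = 1 := by
  have hsq : ‖(a • EuclideanSpace.single 0 (1 : ℝ) + b • EuclideanSpace.single 1 (1 : ℝ) : EuclideanSpace ℝ (Fin 3))‖ ^ 2 = 1 := by
    rw [EuclideanSpace.norm_sq_eq, Fin.sum_univ_three]
    simp
    linarith
  have h0 : 0 ≤ ‖(a • EuclideanSpace.single 0 (1 : ℝ) + b • EuclideanSpace.single 1 (1 : ℝ) : EuclideanSpace ℝ (Fin 3))‖ := norm_nonneg _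
  nlinarith

/-- **THE RIDGE LAW along a regular hot arc, binder level: the transversal curvature is constant.**  See the module docstring for the hypotheses. -/
theorem kappa_const_of_T2bData (hdec : HasTypeITimeDecay C v) (hcont : ContinuousOn (uncurry v) (Iio (0 : ℝ) ×ˢ univ))
    (hmild : ∀ s t : ℝ, s < t → t < 0 → ∀ x, v t x = heatExtension (v s) (t - s) x - oseenDuhamel 1 s v v t x)
    (hdiv : ∀ t < 0, VectorCalculus.IsDivFree (v t))
    (hpol : ∀ s < 0, ∀ y, ⟪curl (v s) y, EuclideanSpace.single 2 1⟫_ℝ = 0)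
    (hTH : ∀ t < 0, ∀ x x' : EuclideanSpace ℝ (Fin 3), x 2 = x' 2 → ∀ b c : Fin 3, b ≠ 2 → c ≠ 2 →
      fderiv ℝ (v t) x (EuclideanSpace.single 2 1) b * fderiv ℝ (v t) x' (EuclideanSpace.single c 1) 2 =
        fderiv ℝ (v t) x' (EuclideanSpace.single 2 1) c * fderiv ℝ (v t) x (EuclideanSpace.single b 1) 2)
    (hne : v (-1) 0 2 ≠ 0) (hhot : ∀ t < 0, ∀ x, Real.sqrt (-t) * |v t x 2| ≤ |v (-1) 0 2|)
    {y₁ : EuclideanSpace ℝ (Fin 3)} (hy₁ : y₁ 2 = 0) {c₁ : Fin 3} (hc₁ : c₁ ≠ 2)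
    (hne₁ : fderiv ℝ (v (-1)) y₁ (EuclideanSpace.single c₁ 1) 2 ≠ 0)
    (hμ1 : fderiv ℝ (v (-1)) y₁ (EuclideanSpace.single 2 1) c₁ ≠ fderiv ℝ (v (-1)) y₁ (EuclideanSpace.single c₁ 1) 2)
    (σ : ℝ) {I : Set ℝ} (hI : IsOpen I) {γ : ℝ → EuclideanSpace ℝ (Fin 3)} {a b c : ℝ → ℝ}
    (hab : ∀ s ∈ I, a s ^ 2 + b s ^ 2 = 1) (hc : ∀ s ∈ I, c s ≠ 0)
    (hγ : ∀ s ∈ I, HasDerivAt γ (c s • (-b s • EuclideanSpace.single 0 (1 : ℝ) + a s • EuclideanSpace.single 1 (1 : ℝ))) s)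
    (hγhot : ∀ s ∈ I, γ s 2 = 0 ∧ v (-1) (γ s) 2 = v (-1) 0 2)
    {ν : ℝ → EuclideanSpace ℝ (Fin 3)} (hνab : ∀ s ∈ I, ν s = a s • EuclideanSpace.single 0 1 + b s • EuclideanSpace.single 1 1)
    {s s' : ℝ} (hs : s ∈ I) (hs' : s' ∈ I) :
    fderiv ℝ (fderiv ℝ (fun y => σ * v (-1) y 2)) (γ s) (ν s) (ν s) = fderiv ℝ (fderiv ℝ (fun y => σ * v (-1) y 2)) (γ s') (ν s') (ν s') ∧
    fderiv ℝ (fderiv ℝ (fun y => σ * v (-1) y 2)) (γ s) (EuclideanSpace.single 2 1) (EuclideanSpace.single 2 1) =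
      fderiv ℝ (fderiv ℝ (fun y => σ * v (-1) y 2)) (γ s') (EuclideanSpace.single 2 1) (EuclideanSpace.single 2 1) := by
  obtain ⟨μ, hμ, hslope, hμ0⟩ := exists_slopeFunction_near_plane hdec hcont hmild hTH hy₁ hc₁ hne₁
  have hμ1' : μ (-1) 0 ≠ 1 := by
    rw [hμ0, Ne, div_eq_one_iff_eq hne₁]
    exact hμ1
  have h := kappa_beta_const_on_hotArc hdec hcont hmild hdiv hpol hμ hslope hμ1' hne hhot σ hI hab hc hγ hγhot hs hs'
  rw [hνab s hs, hνab s' hs']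
  exact h

/-- **THE RIDGE CHAIN, binder level: along a regular, uniformly non-degenerate hot arc of a proper (TH) ridge the squared twist jet `(D²(σv₂(−1,·))(γ s)[ν s, e₂])²` is
quasiconvex.**  See the module docstring for the list of hypotheses and the chain of landed rungs used. -/
theorem quasiconvexOn_sq_nuZ_of_T2bData (hdec : HasTypeITimeDecay C v) (hcont : ContinuousOn (uncurry v) (Iio (0 : ℝ) ×ˢ univ))
    (hmild : ∀ s t : ℝ, s < t → t < 0 → ∀ x, v t x = heatExtension (v s) (t - s) x - oseenDuhamel 1 s v v t x)
    (hdiv : ∀ t < 0, VectorCalculus.IsDivFree (v t))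
    (hpol : ∀ s < 0, ∀ y, ⟪curl (v s) y, EuclideanSpace.single 2 1⟫_ℝ = 0)
    (hTH : ∀ t < 0, ∀ x x' : EuclideanSpace ℝ (Fin 3), x 2 = x' 2 → ∀ b c : Fin 3, b ≠ 2 → c ≠ 2 →
      fderiv ℝ (v t) x (EuclideanSpace.single 2 1) b * fderiv ℝ (v t) x' (EuclideanSpace.single c 1) 2 =
        fderiv ℝ (v t) x' (EuclideanSpace.single 2 1) c * fderiv ℝ (v t) x (EuclideanSpace.single b 1) 2)
    (hpk : ∀ (s z₀ σ M : ℝ) (K O : Set (EuclideanSpace ℝ (Fin 3))), s < 0 →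
      ((σ = 1 ∨ σ = -1) ∧ IsCompact K ∧ K.Nonempty ∧ (∀ y ∈ K, y 2 = z₀ ∧ σ * v s y 2 = M) ∧
        IsOpen O ∧ K ⊆ O ∧ (∀ y ∈ O, y 2 = z₀ → σ * v s y 2 ≤ M) ∧
        (∀ y ∈ O, y 2 = z₀ → σ * v s y 2 = M → y ∈ K)) → False)
    (hcrit : ∀ y ∈ {y : EuclideanSpace ℝ (Fin 3) | y 2 = 0 ∧ v (-1) y 2 = v (-1) 0 2}, fderiv ℝ (fun x => v (-1) x 2) y = 0)
    (hne : v (-1) 0 2 ≠ 0) (hhot : ∀ t < 0, ∀ x, Real.sqrt (-t) * |v t x 2| ≤ |v (-1) 0 2|)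
    {y₁ : EuclideanSpace ℝ (Fin 3)} (hy₁ : y₁ 2 = 0) {c₁ : Fin 3} (hc₁ : c₁ ≠ 2)
    (hne₁ : fderiv ℝ (v (-1)) y₁ (EuclideanSpace.single c₁ 1) 2 ≠ 0)
    (hμ1 : fderiv ℝ (v (-1)) y₁ (EuclideanSpace.single 2 1) c₁ ≠ fderiv ℝ (v (-1)) y₁ (EuclideanSpace.single c₁ 1) 2)
    {C₃ : ℝ} (hC₃ : ∀ x, ‖iteratedFDeriv ℝ 3 (v (-1)) x‖ ≤ C₃)
    {σ : ℝ} (hσ : σ = 1 ∨ σ = -1)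
    (e : OpenPartialHomeomorph (ℝ × ℝ) (ℝ × ℝ)) {a₁ a₂ r : ℝ} (ha : a₁ ≤ a₂) (hr : 0 < r) (hsrc : Icc a₁ a₂ ×ˢ Icc (-r) r ⊆ e.source)
    {P : ℝ → ℝ × ℝ → EuclideanSpace ℝ (Fin 3)} (hP : ∀ z₀ q, P z₀ q = WithLp.toLp 2 ![q.1, q.2, z₀])
    {I : Set ℝ} (hI : IsOpen I) (hIcc : Icc a₁ a₂ ⊆ I) {γ ν : ℝ → EuclideanSpace ℝ (Fin 3)} {a b c : ℝ → ℝ}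
    (hab : ∀ s ∈ I, a s ^ 2 + b s ^ 2 = 1) (hc : ∀ s ∈ I, c s ≠ 0)
    (hγ : ∀ s ∈ I, HasDerivAt γ (c s • (-b s • EuclideanSpace.single 0 (1 : ℝ) + a s • EuclideanSpace.single 1 (1 : ℝ))) s)
    (hγhot : ∀ s ∈ I, γ s 2 = 0 ∧ v (-1) (γ s) 2 = v (-1) 0 2)
    (hνab : ∀ s ∈ I, ν s = a s • EuclideanSpace.single 0 1 + b s • EuclideanSpace.single 1 1)
    (hγν : ∀ s ∈ Icc a₁ a₂, ∀ n z : ℝ, P z (e (s, n)) = γ s + n • ν s + z • EuclideanSpace.single 2 1)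
    (hlat0 : ∀ a ∈ Icc a₁ a₂, ∀ n : ℝ, (n = r ∨ n = -r) → σ * v (-1) (P 0 (e (a, n))) 2 < σ * v (-1) 0 2)
    (hκ0 : 0 < -(fderiv ℝ (fderiv ℝ (fun y => σ * v (-1) y 2)) (γ a₁) (ν a₁) (ν a₁)))
    (hthin : 64 * C₃ * r ≤ -(fderiv ℝ (fderiv ℝ (fun y => σ * v (-1) y 2)) (γ a₁) (ν a₁) (ν a₁))) :
    QuasiconvexOn ℝ (Icc a₁ a₂) fun s =>
      (fderiv ℝ (fderiv ℝ (fun y => σ * v (-1) y 2)) (γ s) (ν s) (EuclideanSpace.single 2 1)) ^ 2 := by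
  have ha₁ : a₁ ∈ I := hIcc (left_mem_Icc.2 ha)
  -- slice bound of order two from the class (KNSS)
  have hv : IsTypeIAncientMild C v := isTypeIAncientMild_of_class hdec hcont hmild hdiv
  obtain ⟨C₂, hC₂⟩ := hv.exists_norm_iteratedFDeriv_le_slice (show (-1 : ℝ) < 0 by norm_num) 2
  -- the ridge law: `κ`, `β` constant along the arc
  have hlaw := fun s (hs : s ∈ Icc a₁ a₂) =>
    kappa_const_of_T2bData hdec hcont hmild hdiv hpol hTH hne hhot hy₁ hc₁ hne₁ hμ1 σ hI hab hc hγ hγhot hνab (hIcc hs) ha₁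
  have hν : ∀ s ∈ Icc a₁ a₂, ‖ν s‖ ≤ 1 := fun s hs => by
    rw [hνab s (hIcc hs), norm_frameNormal_eq_one (hab s (hIcc hs))]
  exact quasiconvexOn_sq_nuZ_of_class hdec hcont hmild hpk hcrit hC₂ hC₃ hσ e ha hr hsrc hP hγν hν (fun s hs => hγhot s (hIcc hs)) hlat0
    (α := fun s => fderiv ℝ (fderiv ℝ (fun y => σ * v (-1) y 2)) (γ s) (ν s) (EuclideanSpace.single 2 1)) hκ0 hthin
    (fun s hs => by rw [(hlaw s hs).1]) (fun s _ => rfl) (fun s hs => (hlaw s hs).2.symm)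

end Summit.NavierStokesRegularity.NavierStokesRegularity.Theorems.PoloidalWindowDoorLrcModEntireTwistingTHRidgeChain
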